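import Summits.Ventures.CertifiedManyBodySolver.Observables.SourcedGibbsTrialCapKSpaceRiemann
import Literature.Barriers.HubbardSuperconductivity.WeakCouplingCeiling
import HarnessLib

/-!
# The HF–BCS sourced cap in momentum space (VI): Lipschitz constant of the BdG density integrand and the
# uniform-in-`L` Riemann bound for the density sum

HONEST FRAMING: zero compute; proved real-analysis lemmas towards the `∃ L₀ ∀ L ≥ L₀` packaging of the certified
HF–BCS cap. The density summand `1 − ξ_k tanh(βE_k/2)/E_k` of `groundEnergy_dWaveSourceTorus_le_HFBCS_kSpace'` is a
Riemann sum of a `2π`-periodic integrand which is Lipschitz in each momentum with constant `K₂ = β(3 + 2√2|h|)`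
(`β ≥ 0`; derivative-free proof, valid through the nodal points `E = 0` with Lean's `x/0 = 0`), whence the
Davis–Rabinowitz bound and the two-grid control `|n_L − n_{L'}| ≤ 2πK₂(1/L + 1/L')`. No number claimed; not a
statement about order; not a superconductivity verdict.

* `abs_tanh_sub_tanh_le` — `tanh` is `1`-Lipschitz (`0 ≤ tanh w ≤ w` for `w ≥ 0` is REUSED:
  `Literature.Barriers.HubbardSuperconductivity.tanh_le_self`);
* `abs_mul_tanh_div_sub_le` — the nodal-safe estimate `|ξ'|·|tanh(βE/2)/E − tanh(βE'/2)/E'| ≤ β|E − E'|` for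
  `|ξ'| ≤ E'`, `0 ≤ E`;
* `abs_bdgDensity_sub_le_fst/snd` — per-momentum Lipschitz constant `β(3 + 2√2|h|)` of `ξ tanh(βE/2)/E`;
* `abs_sum_bdgDensity_sub_integral_le`, `abs_bdgDensity_two_grid_le` — Davis–Rabinowitz and two-grid bounds for
  `Σ_k (1 − ξ_k tanh(βE_k/2)/E_k)`.

References: Davis–Rabinowitz, *Methods of Numerical Integration* (1984) §2.1 (2.1.6) [DavisRabinowitz1984];
von Delft–Ralph, Phys. Rep. 345 (2001) 61, §4.2 [VondelftRalph2001].
-/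

noncomputable section

open Real Finset Literature.MathematicalPhysics.QuantumLattice Literature.Probability.LatticeModels

namespace Summit.Ventures.CertifiedManyBodySolver.Observables

/-! ### §1 Elementary `tanh` facts -/

/-- `tanh` is `1`-Lipschitz: `|tanh a − tanh b| ≤ |a − b|` (`tanh' = 1/cosh² ≤ 1`). [folklore] -/
theorem abs_tanh_sub_tanh_le (a b : ℝ) : |Real.tanh a - Real.tanh b| ≤ |a - b| := by
  have hder : ∀ w : ℝ, HasDerivAt Real.tanh (1 / Real.cosh w ^ 2) w := by
    intro w
    have hne : Real.cosh w ≠ 0 := (Real.cosh_pos _).ne'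
    have h := (Real.hasDerivAt_sinh w).div (Real.hasDerivAt_cosh w) hne
    have hfun : Real.tanh = fun v => Real.sinh v / Real.cosh v := by
      funext v; exact Real.tanh_eq_sinh_div_cosh v
    rw [hfun]
    refine h.congr_deriv ?_
    have := Real.cosh_sq_sub_sinh_sq w
    field_simp
    linear_combination this
  have hdiff : Differentiable ℝ Real.tanh := fun w => (hder w).differentiableAt
  have hbound : ∀ w : ℝ, ‖deriv Real.tanh w‖₊ ≤ (1 : NNReal) := by
    intro w
    rw [(hder w).deriv, ← NNReal.coe_le_coe, coe_nnnorm, Real.norm_eq_abs, NNReal.coe_one,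
      abs_of_pos (by positivity)]
    have h1 := Real.one_le_cosh w
    rw [div_le_one (by positivity)]
    nlinarith
  have := (lipschitzWith_of_nnnorm_deriv_le hdiff hbound).dist_le_mul a b
  simpa [Real.dist_eq] using this

/-- `tanh(βE/2)/E ≤ β/2` in absolute value (`β, E ≥ 0`; also `E = 0`). [folklore] -/
theorem abs_tanh_div_le {β E : ℝ} (hβ : 0 ≤ β) (hE : 0 ≤ E) : |Real.tanh (β * E / 2) / E| ≤ β / 2 := by
  rcases eq_or_lt_of_le hE with hE0 | hE0
  · rw [← hE0]; simp; positivity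
  · have hw : 0 ≤ β * E / 2 := by positivity
    rw [abs_div, abs_of_nonneg (by rw [Real.tanh_eq_sinh_div_cosh]; exact div_nonneg (Real.sinh_nonneg_iff.2 hw) (Real.cosh_pos _).le),
      abs_of_pos hE0, div_le_iff₀ hE0]
    have := Literature.Barriers.HubbardSuperconductivity.tanh_le_self hw
    linarith

/-! ### §2 The nodal-safe estimate for `ξ·tanh(βE/2)/E` -/

/-- **Nodal-safe estimate**: for `0 ≤ β`, `0 ≤ E` and `|ξ'| ≤ E'`,
`|ξ'|·|tanh(βE/2)/E − tanh(βE'/2)/E'| ≤ β·|E − E'|` (`tanh` is `1`-Lipschitz and `tanh(w) ≤ w`; with `x/0 = 0` the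
estimate holds through `E = 0`). [folklore] -/
theorem abs_mul_tanh_div_sub_le {β E E' ξ' : ℝ} (hβ : 0 ≤ β) (hE : 0 ≤ E) (hξ' : |ξ'| ≤ E') :
    |ξ'| * |Real.tanh (β * E / 2) / E - Real.tanh (β * E' / 2) / E'| ≤ β * |E - E'| := by
  have hE' : 0 ≤ E' := (abs_nonneg _).trans hξ'
  -- reduce to `E' · |q(E) − q(E')|`
  have step : |ξ'| * |Real.tanh (β * E / 2) / E - Real.tanh (β * E' / 2) / E'| ≤
      E' * |Real.tanh (β * E / 2) / E - Real.tanh (β * E' / 2) / E'| :=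
    mul_le_mul_of_nonneg_right hξ' (abs_nonneg _)
  refine step.trans ?_
  rcases eq_or_lt_of_le hE' with hE'0 | hE'0
  · rw [← hE'0]; simp; positivity
  have htL := abs_tanh_sub_tanh_le (β * E / 2) (β * E' / 2)
  have hq := abs_tanh_div_le hβ hE
  rcases eq_or_lt_of_le hE with hE0 | hE0
  · -- `E = 0`: `E' q(E') = tanh(βE'/2) ≤ βE'/2`
    rw [← hE0]
    have ht0 : 0 ≤ Real.tanh (β * E' / 2) := by
      rw [Real.tanh_eq_sinh_div_cosh]
      exact div_nonneg (Real.sinh_nonneg_iff.2 (by positivity)) (Real.cosh_pos _).le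
    have hq' : |Real.tanh (β * 0 / 2) / 0 - Real.tanh (β * E' / 2) / E'| = Real.tanh (β * E' / 2) / E' := by
      rw [div_zero, zero_sub, abs_neg, abs_of_nonneg (div_nonneg ht0 hE')]
    rw [hq', mul_div_cancel₀ _ hE'0.ne', zero_sub, abs_neg, abs_of_pos hE'0]
    have := Literature.Barriers.HubbardSuperconductivity.tanh_le_self (show 0 ≤ β * E' / 2 by positivity)
    nlinarith
  · -- `E, E' > 0`: `E'(q(E) − q(E')) = (E'/E − 1) tanh(βE/2) + (tanh(βE/2) − tanh(βE'/2))`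
    have e : E' * (Real.tanh (β * E / 2) / E - Real.tanh (β * E' / 2) / E') =
        (E' - E) * (Real.tanh (β * E / 2) / E) + (Real.tanh (β * E / 2) - Real.tanh (β * E' / 2)) := by
      field_simp
      ring
    have habs : E' * |Real.tanh (β * E / 2) / E - Real.tanh (β * E' / 2) / E'| =
        |E' * (Real.tanh (β * E / 2) / E - Real.tanh (β * E' / 2) / E')| := by
      rw [abs_mul, abs_of_pos hE'0]
    rw [habs, e]
    refine (abs_add_le _ _).trans ?_
    rw [abs_mul]
    have h1 : |E' - E| * |Real.tanh (β * E / 2) / E| ≤ |E - E'| * (β / 2) := by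
      rw [abs_sub_comm]; exact mul_le_mul_of_nonneg_left hq (abs_nonneg _)
    have h2 : |Real.tanh (β * E / 2) - Real.tanh (β * E' / 2)| ≤ β / 2 * |E - E'| := by
      refine htL.trans (le_of_eq ?_)
      rw [show β * E / 2 - β * E' / 2 = β / 2 * (E - E') by ring, abs_mul, abs_of_nonneg (by positivity)]
    nlinarith [h1, h2, abs_nonneg (E - E')]

/-- **The BdG density numerator `ξ·tanh(βE/2)/E` as a function of `(ξ, g)`**: for `0 ≤ β`,
`|ξ q(E) − ξ' q(E')| ≤ (β/2)|ξ − ξ'| + β(|ξ − ξ'| + |g − g'|)`, `E = √(ξ² + g²)`, `q(E) = tanh(βE/2)/E`.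
[cite: VondelftRalph2001, §4.2] -/
theorem abs_bdgDensityNum_sub_le {β : ℝ} (hβ : 0 ≤ β) (ξ g ξ' g' : ℝ) :
    |ξ * (Real.tanh (β * Real.sqrt (ξ ^ 2 + g ^ 2) / 2) / Real.sqrt (ξ ^ 2 + g ^ 2)) -
      ξ' * (Real.tanh (β * Real.sqrt (ξ' ^ 2 + g' ^ 2) / 2) / Real.sqrt (ξ' ^ 2 + g' ^ 2))| ≤
      β / 2 * |ξ - ξ'| + β * (|ξ - ξ'| + |g - g'|) := by
  set E := Real.sqrt (ξ ^ 2 + g ^ 2) with hE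
  set E' := Real.sqrt (ξ' ^ 2 + g' ^ 2) with hE'
  have hE0 : 0 ≤ E := Real.sqrt_nonneg _
  have hξ'E' : |ξ'| ≤ E' := by
    rw [hE', ← Real.sqrt_sq_eq_abs]
    exact Real.sqrt_le_sqrt (by nlinarith [sq_nonneg g'])
  -- split `ξ q − ξ' q' = (ξ − ξ') q + ξ' (q − q')`
  have e : ξ * (Real.tanh (β * E / 2) / E) - ξ' * (Real.tanh (β * E' / 2) / E') =
      (ξ - ξ') * (Real.tanh (β * E / 2) / E) + ξ' * (Real.tanh (β * E / 2) / E - Real.tanh (β * E' / 2) / E') := by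
    ring
  rw [e]
  refine (abs_add_le _ _).trans ?_
  rw [abs_mul, abs_mul]
  have h1 : |ξ - ξ'| * |Real.tanh (β * E / 2) / E| ≤ β / 2 * |ξ - ξ'| := by
    rw [mul_comm]; exact mul_le_mul_of_nonneg_right (abs_tanh_div_le hβ hE0) (abs_nonneg _)
  have h2 := abs_mul_tanh_div_sub_le hβ hE0 hξ'E'
  have h3 : |E - E'| ≤ |ξ - ξ'| + |g - g'| := abs_sqrt_sq_add_sq_sub_le ξ g ξ' g'
  have h4 : β * |E - E'| ≤ β * (|ξ - ξ'| + |g - g'|) := mul_le_mul_of_nonneg_left h3 hβ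
  linarith [h1, h2, h4]

/-! ### §3 Per-momentum Lipschitz constants of the density integrand -/

/-- **The BdG density numerator is Lipschitz in the first momentum** with constant `β(3 + 2√2|h|)` (`β ≥ 0`).
[cite: DavisRabinowitz1984, §2.1 eq. (2.1.6)] -/
theorem abs_bdgDensity_sub_le_fst {β : ℝ} (hβ : 0 ≤ β) (μ' h x x' y : ℝ) :
    |(-2 * (Real.cos x + Real.cos y) - μ') *
        (Real.tanh (β * Real.sqrt ((-2 * (Real.cos x + Real.cos y) - μ') ^ 2 +
          (2 * Real.sqrt 2 * h * (Real.cos x - Real.cos y)) ^ 2) / 2) /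
          Real.sqrt ((-2 * (Real.cos x + Real.cos y) - μ') ^ 2 + (2 * Real.sqrt 2 * h * (Real.cos x - Real.cos y)) ^ 2)) -
      (-2 * (Real.cos x' + Real.cos y) - μ') *
        (Real.tanh (β * Real.sqrt ((-2 * (Real.cos x' + Real.cos y) - μ') ^ 2 +
          (2 * Real.sqrt 2 * h * (Real.cos x' - Real.cos y)) ^ 2) / 2) /
          Real.sqrt ((-2 * (Real.cos x' + Real.cos y) - μ') ^ 2 + (2 * Real.sqrt 2 * h * (Real.cos x' - Real.cos y)) ^ 2))| ≤
      β * (3 + 2 * Real.sqrt 2 * |h|) * |x - x'| := by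
  refine (abs_bdgDensityNum_sub_le hβ _ _ _ _).trans ?_
  have hcos := Real.abs_cos_sub_cos_le x x'
  have e1 : (-2 * (Real.cos x + Real.cos y) - μ') - (-2 * (Real.cos x' + Real.cos y) - μ') =
      -2 * (Real.cos x - Real.cos x') := by ring
  have e2 : 2 * Real.sqrt 2 * h * (Real.cos x - Real.cos y) - 2 * Real.sqrt 2 * h * (Real.cos x' - Real.cos y) =
      (2 * Real.sqrt 2 * h) * (Real.cos x - Real.cos x') := by ring
  rw [e1, e2]
  simp only [abs_mul, abs_neg, abs_two, abs_of_nonneg (Real.sqrt_nonneg 2)]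
  have hnn : 0 ≤ 2 * Real.sqrt 2 * |h| := by positivity
  have hd : 0 ≤ |Real.cos x - Real.cos x'| := abs_nonneg _
  nlinarith [hcos, hnn, hd, mul_nonneg hβ hnn, mul_nonneg hβ hd, mul_nonneg (mul_nonneg hβ hnn) hd,
    mul_nonneg (mul_nonneg hβ hnn) (sub_nonneg.2 hcos), mul_nonneg hβ (sub_nonneg.2 hcos)]

/-- **The BdG density numerator is Lipschitz in the second momentum** with constant `β(3 + 2√2|h|)` (`β ≥ 0`).
[cite: DavisRabinowitz1984, §2.1 eq. (2.1.6)] -/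
theorem abs_bdgDensity_sub_le_snd {β : ℝ} (hβ : 0 ≤ β) (μ' h x y y' : ℝ) :
    |(-2 * (Real.cos x + Real.cos y) - μ') *
        (Real.tanh (β * Real.sqrt ((-2 * (Real.cos x + Real.cos y) - μ') ^ 2 +
          (2 * Real.sqrt 2 * h * (Real.cos x - Real.cos y)) ^ 2) / 2) /
          Real.sqrt ((-2 * (Real.cos x + Real.cos y) - μ') ^ 2 + (2 * Real.sqrt 2 * h * (Real.cos x - Real.cos y)) ^ 2)) -
      (-2 * (Real.cos x + Real.cos y') - μ') *
        (Real.tanh (β * Real.sqrt ((-2 * (Real.cos x + Real.cos y') - μ') ^ 2 +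
          (2 * Real.sqrt 2 * h * (Real.cos x - Real.cos y')) ^ 2) / 2) /
          Real.sqrt ((-2 * (Real.cos x + Real.cos y') - μ') ^ 2 + (2 * Real.sqrt 2 * h * (Real.cos x - Real.cos y')) ^ 2))| ≤
      β * (3 + 2 * Real.sqrt 2 * |h|) * |y - y'| := by
  refine (abs_bdgDensityNum_sub_le hβ _ _ _ _).trans ?_
  have hcos := Real.abs_cos_sub_cos_le y y'
  have e1 : (-2 * (Real.cos x + Real.cos y) - μ') - (-2 * (Real.cos x + Real.cos y') - μ') =
      -2 * (Real.cos y - Real.cos y') := by ring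
  have e2 : 2 * Real.sqrt 2 * h * (Real.cos x - Real.cos y) - 2 * Real.sqrt 2 * h * (Real.cos x - Real.cos y') =
      -(2 * Real.sqrt 2 * h) * (Real.cos y - Real.cos y') := by ring
  rw [e1, e2]
  simp only [abs_mul, abs_neg, abs_two, abs_of_nonneg (Real.sqrt_nonneg 2)]
  have hnn : 0 ≤ 2 * Real.sqrt 2 * |h| := by positivity
  have hd : 0 ≤ |Real.cos y - Real.cos y'| := abs_nonneg _
  nlinarith [hcos, hnn, hd, mul_nonneg hβ hnn, mul_nonneg hβ hd, mul_nonneg (mul_nonneg hβ hnn) hd,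
    mul_nonneg (mul_nonneg hβ hnn) (sub_nonneg.2 hcos), mul_nonneg hβ (sub_nonneg.2 hcos)]

/-! ### §4 Davis–Rabinowitz and two-grid bounds for the density sum -/

/-- **Davis–Rabinowitz bound for the BdG density sum** (every `L ≥ 1`, `β ≥ 0`):
`|Σ_k (1 − ξ_k tanh(βE_k/2)/E_k) − L²/(4π²)∫∫(1 − ξ tanh(βE/2)/E)| ≤ 2π·β(3 + 2√2|h|)·L`.
[cite: DavisRabinowitz1984, §2.1 eq. (2.1.6)] -/
theorem abs_sum_bdgDensity_sub_integral_le (L : ℕ) [NeZero L] {β : ℝ} (hβ : 0 ≤ β) (μ' h : ℝ) :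
    |(∑ k : TorusSite 2 L,
        (1 - (torusBand L k - μ') *
          Real.tanh (β * Real.sqrt ((torusBand L k - μ') ^ 2 + (2 * Real.sqrt 2 * h * dWaveGap k) ^ 2) / 2) /
            Real.sqrt ((torusBand L k - μ') ^ 2 + (2 * Real.sqrt 2 * h * dWaveGap k) ^ 2))) -
      (L : ℝ) ^ 2 / (4 * π ^ 2) * ∫ y in (-π)..π, ∫ x in (-π)..π,
        (1 - (-2 * (Real.cos x + Real.cos y) - μ') *
          (Real.tanh (β * Real.sqrt ((-2 * (Real.cos x + Real.cos y) - μ') ^ 2 +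
            (2 * Real.sqrt 2 * h * (Real.cos x - Real.cos y)) ^ 2) / 2) /
            Real.sqrt ((-2 * (Real.cos x + Real.cos y) - μ') ^ 2 + (2 * Real.sqrt 2 * h * (Real.cos x - Real.cos y)) ^ 2)))| ≤
      2 * π * (β * (3 + 2 * Real.sqrt 2 * |h|)) * L := by
  have hK : (0 : ℝ) ≤ β * (3 + 2 * Real.sqrt 2 * |h|) := by positivity
  have key := abs_sum_torusSite_two_sub_integral_le
    (f := fun x y => 1 - (-2 * (Real.cos x + Real.cos y) - μ') *
          (Real.tanh (β * Real.sqrt ((-2 * (Real.cos x + Real.cos y) - μ') ^ 2 +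
            (2 * Real.sqrt 2 * h * (Real.cos x - Real.cos y)) ^ 2) / 2) /
            Real.sqrt ((-2 * (Real.cos x + Real.cos y) - μ') ^ 2 + (2 * Real.sqrt 2 * h * (Real.cos x - Real.cos y)) ^ 2)))
    hK
    (fun y x => by simp only [Real.cos_add_two_pi])
    (fun x y => by simp only [Real.cos_add_two_pi])
    (fun x x' y => by
      rw [show ∀ a b : ℝ, (1 - a) - (1 - b) = -(a - b) from fun a b => by ring, abs_neg]
      exact abs_bdgDensity_sub_le_fst hβ μ' h x x' y)
    (fun x y y' => by
      rw [show ∀ a b : ℝ, (1 - a) - (1 - b) = -(a - b) from fun a b => by ring, abs_neg]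
      exact abs_bdgDensity_sub_le_snd hβ μ' h x y y') L
  have hsum : ∀ k : TorusSite 2 L,
      (1 - (torusBand L k - μ') *
          Real.tanh (β * Real.sqrt ((torusBand L k - μ') ^ 2 + (2 * Real.sqrt 2 * h * dWaveGap k) ^ 2) / 2) /
            Real.sqrt ((torusBand L k - μ') ^ 2 + (2 * Real.sqrt 2 * h * dWaveGap k) ^ 2)) =
        (1 - (-2 * (Real.cos (latticeMomentum L k 0) + Real.cos (latticeMomentum L k 1)) - μ') *
          (Real.tanh (β * Real.sqrt ((-2 * (Real.cos (latticeMomentum L k 0) + Real.cos (latticeMomentum L k 1)) - μ') ^ 2 +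
            (2 * Real.sqrt 2 * h * (Real.cos (latticeMomentum L k 0) - Real.cos (latticeMomentum L k 1))) ^ 2) / 2) /
            Real.sqrt ((-2 * (Real.cos (latticeMomentum L k 0) + Real.cos (latticeMomentum L k 1)) - μ') ^ 2 +
              (2 * Real.sqrt 2 * h * (Real.cos (latticeMomentum L k 0) - Real.cos (latticeMomentum L k 1))) ^ 2))) := by
    intro k
    simp only [torusBand, dWaveGap, Fin.sum_univ_two, mul_div_assoc]
  rw [Finset.sum_congr rfl fun k _ => hsum k]
  exact key

/-- **Two momentum grids differ by `O(1/L + 1/L')` per site** for the BdG density sum: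
`|n_L − n_{L'}| ≤ 2π·β(3 + 2√2|h|)·(1/L + 1/L')`, `n_L = L⁻² Σ_k (1 − ξ_k tanh(βE_k/2)/E_k)` (`β ≥ 0`).
[cite: DavisRabinowitz1984, §2.1 eq. (2.1.6)] -/
theorem abs_bdgDensity_two_grid_le (L L' : ℕ) [NeZero L] [NeZero L'] {β : ℝ} (hβ : 0 ≤ β) (μ' h : ℝ) :
    |(∑ k : TorusSite 2 L,
        (1 - (torusBand L k - μ') *
          Real.tanh (β * Real.sqrt ((torusBand L k - μ') ^ 2 + (2 * Real.sqrt 2 * h * dWaveGap k) ^ 2) / 2) /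
            Real.sqrt ((torusBand L k - μ') ^ 2 + (2 * Real.sqrt 2 * h * dWaveGap k) ^ 2))) / (L : ℝ) ^ 2 -
      (∑ k : TorusSite 2 L',
        (1 - (torusBand L' k - μ') *
          Real.tanh (β * Real.sqrt ((torusBand L' k - μ') ^ 2 + (2 * Real.sqrt 2 * h * dWaveGap k) ^ 2) / 2) /
            Real.sqrt ((torusBand L' k - μ') ^ 2 + (2 * Real.sqrt 2 * h * dWaveGap k) ^ 2))) / (L' : ℝ) ^ 2| ≤
      2 * π * (β * (3 + 2 * Real.sqrt 2 * |h|)) * (1 / (L : ℝ) + 1 / (L' : ℝ)) := by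
  have hL : (0 : ℝ) < L := Nat.cast_pos.2 (Nat.pos_of_ne_zero (NeZero.ne L))
  have hL' : (0 : ℝ) < L' := Nat.cast_pos.2 (Nat.pos_of_ne_zero (NeZero.ne L'))
  have h1 := abs_sum_bdgDensity_sub_integral_le L hβ μ' h
  have h2 := abs_sum_bdgDensity_sub_integral_le L' hβ μ' h
  set K := 2 * π * (β * (3 + 2 * Real.sqrt 2 * |h|)) with hKdef
  set I := ∫ y in (-π)..π, ∫ x in (-π)..π,
        (1 - (-2 * (Real.cos x + Real.cos y) - μ') *
          (Real.tanh (β * Real.sqrt ((-2 * (Real.cos x + Real.cos y) - μ') ^ 2 +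
            (2 * Real.sqrt 2 * h * (Real.cos x - Real.cos y)) ^ 2) / 2) /
            Real.sqrt ((-2 * (Real.cos x + Real.cos y) - μ') ^ 2 + (2 * Real.sqrt 2 * h * (Real.cos x - Real.cos y)) ^ 2)))
    with hI
  set S := ∑ k : TorusSite 2 L,
        (1 - (torusBand L k - μ') *
          Real.tanh (β * Real.sqrt ((torusBand L k - μ') ^ 2 + (2 * Real.sqrt 2 * h * dWaveGap k) ^ 2) / 2) /
            Real.sqrt ((torusBand L k - μ') ^ 2 + (2 * Real.sqrt 2 * h * dWaveGap k) ^ 2)) with hS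
  set S' := ∑ k : TorusSite 2 L',
        (1 - (torusBand L' k - μ') *
          Real.tanh (β * Real.sqrt ((torusBand L' k - μ') ^ 2 + (2 * Real.sqrt 2 * h * dWaveGap k) ^ 2) / 2) /
            Real.sqrt ((torusBand L' k - μ') ^ 2 + (2 * Real.sqrt 2 * h * dWaveGap k) ^ 2)) with hS'
  have h1' : |S / (L : ℝ) ^ 2 - I / (4 * π ^ 2)| ≤ K * (1 / (L : ℝ)) := by
    have hL2 : (0 : ℝ) < (L : ℝ) ^ 2 := by positivity
    have e : S / (L : ℝ) ^ 2 - I / (4 * π ^ 2) = (S - (L : ℝ) ^ 2 / (4 * π ^ 2) * I) / (L : ℝ) ^ 2 := by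
      field_simp
    rw [e, abs_div, abs_of_pos hL2, div_le_iff₀ hL2]
    calc |S - (L : ℝ) ^ 2 / (4 * π ^ 2) * I| ≤ K * L := h1
      _ = K * (1 / (L : ℝ)) * (L : ℝ) ^ 2 := by field_simp
  have h2' : |S' / (L' : ℝ) ^ 2 - I / (4 * π ^ 2)| ≤ K * (1 / (L' : ℝ)) := by
    have hL2 : (0 : ℝ) < (L' : ℝ) ^ 2 := by positivity
    have e : S' / (L' : ℝ) ^ 2 - I / (4 * π ^ 2) = (S' - (L' : ℝ) ^ 2 / (4 * π ^ 2) * I) / (L' : ℝ) ^ 2 := by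
      field_simp
    rw [e, abs_div, abs_of_pos hL2, div_le_iff₀ hL2]
    calc |S' - (L' : ℝ) ^ 2 / (4 * π ^ 2) * I| ≤ K * L' := h2
      _ = K * (1 / (L' : ℝ)) * (L' : ℝ) ^ 2 := by field_simp
  have e3 : S / (L : ℝ) ^ 2 - S' / (L' : ℝ) ^ 2 =
      (S / (L : ℝ) ^ 2 - I / (4 * π ^ 2)) - (S' / (L' : ℝ) ^ 2 - I / (4 * π ^ 2)) := by ring
  rw [e3]
  refine (abs_sub _ _).trans ?_
  rw [mul_add]
  exact add_le_add h1' h2'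

end Summit.Ventures.CertifiedManyBodySolver.Observables

end
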